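import Summits.BirchSwinnertonDyer.BirchSwinnertonDyer.Theses.SchneiderFreeAdditiveX3
import HarnessLib

/-!
# BC3 birth skeleton — crux `BranchMCPotGoodTwo` of route `SchneiderFreeAdditiveX3` (cell bsd-schneider-ideate, seat P2 «around»)

Route-typed publication copy (g6) of the g5 birth skeleton `bc/BranchMCPotGoodTwo_birth.lean` (which simulated the
sockets + the rendered route in-file before the Theses module existed). Sorries ONLY inside `stub_*`;
`BranchMCPotGoodTwo_of` is a real proof (no `sorry` of its own) composing the three named stubs and is the
ONLY theorem of the file concluding the ROUTE decl
`Summit.BirchSwinnertonDyer.BirchSwinnertonDyer.Theses.SchneiderFreeAdditiveX3.BranchMCPotGoodTwo` BY NAME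
(g6 fix: the g5 hypothesis-form `_of` + `_of_stubs` pair gave the checker two candidates).
-/

noncomputable section

section BirthSkeleton

open scoped Classical

open WeierstrassCurve NumberField IsDedekindDomain Field Literature.NumberTheory.EllipticCurves
  Literature.NumberTheory.EllipticCurves.ModularForms
  Literature.NumberTheory.EllipticCurves.GreenbergSelmer
  Literature.NumberTheory.EllipticCurves.Rank1Residual
  Literature.NumberTheory.EllipticCurves.Rank1Residual.Typed
  Summit.BirchSwinnertonDyer.Rank1Residual
  Summit.BirchSwinnertonDyer.Rank1Residual.X11b
  Summit.BirchSwinnertonDyer.Rank1Residual.X11b.AcSelmer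
  Summit.BirchSwinnertonDyer.Rank1Residual.X11b.Halves
  Summit.BirchSwinnertonDyer.BirchSwinnertonDyer.Theorems.SchneiderFree
  Summit.BirchSwinnertonDyer.BirchSwinnertonDyer.Theses.SchneiderFreeAdditiveX3

namespace Summit.BirchSwinnertonDyer.BirchSwinnertonDyer.Cruxes.BranchMCPotGoodTwo.Birth

/-- STUB 1 (CTL₀ on cell (G-ord, `e = 2`), size M–L): `X_ac = XAc (E_K) p κ 𝔭 ∅ γ` is `Λ`-torsion with
a characteristic generator of non-zero constant term at every admissible datum/frame. Plan: LZZ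
non-vanishing at `𝟙` + control EQUALITY (crux `AdditiveAnticycControl`). -/
theorem stub_goodTwo_charTorsion :
    ∀ (W : WeierstrassCurve ℚ) [W.IsElliptic] [W.IsGloballyMinimal] (p : ℕ) [Fact p.Prime],
      W.analyticRank = 1 → p ≠ 2 → ClassX3 W p → Additive.SubGordTwo W p →
      ∀ (N : ℕ) [NeZero N] (K : Type) [Field K] [NumberField K]
        (Dt : ModularParametrizationData W N) (H : HeegnerDatum N (NumberField.discr K)) (ι : K →+* ℂ)
        (P : (W.baseChange K).toAffine.Point),
        W.analyticRank = 1 → Additive.N10.Locus W p → W.conductorNorm ℤ = N → IsImaginaryQuadratic K →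
        Odd (NumberField.discr K) → ¬ p ∣ Units.torsionOrder K → SatisfiesHeegnerHypothesis N K →
        (W.quadraticTwist (NumberField.discr K : ℚ)).entireLFunction 1 ≠ 0 →
        WeierstrassCurve.Affine.Point.map ι.toRatAlgHom P = heegnerPointComplex Dt H →
        ¬ (p : ℤ) ∣ Dt.c → ¬ IsOfFinAddOrder P →
        ∀ (κ : ZpExtension K p), κ.IsAnticyclotomic →
          ∀ (γ : Field.absoluteGaloisGroup K) [Fact (κ.IsTopGenerator γ)]
            (𝔭 : HeightOneSpectrum (𝓞 K)) (h𝔭 : ((p : ℕ) : 𝓞 K) ∈ 𝔭.asIdeal)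
            (he : 𝔭.asIdeal.ramificationIdx (𝓞 ℚ) = 1) (hf : 𝔭.asIdeal.inertiaDeg (𝓞 ℚ) = 1),
            ∃ n : ℕ, XAc.HasCharValuationAt (W.baseChange K) p κ 𝔭 ∅ γ n := by
  sorry

/-- STUB 2 (divisibility at `p ≥ 5`, size L, PRE): `2·ord_p log_ω P ≤ ord_p f(0)` on (G-ord, `e = 2`)
at `p ≥ 5` — Keller–Yin arXiv:2410.23241 Thm. 3.5.1 (Greenberg main conjecture ⊇ for the GOOD
ORDINARY twist `V = E ⊗ ε`, `p ∤ N_V`, residually reducible = X3) on the `χ_ε`-branch + LZZ Thm. 1.8;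
inside KY's printed hypotheses `p ∤ 6N_V` (149 of the cell's 2 560 pairs). -/
theorem stub_goodTwo_divisibility_five_le :
    ∀ (W : WeierstrassCurve ℚ) [W.IsElliptic] [W.IsGloballyMinimal] (p : ℕ) [Fact p.Prime],
      W.analyticRank = 1 → p ≠ 2 → ClassX3 W p → Additive.SubGordTwo W p → 5 ≤ p →
      ∀ (N : ℕ) [NeZero N] (K : Type) [Field K] [NumberField K]
        (Dt : ModularParametrizationData W N) (H : HeegnerDatum N (NumberField.discr K)) (ι : K →+* ℂ)
        (P : (W.baseChange K).toAffine.Point),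
        W.analyticRank = 1 → Additive.N10.Locus W p → W.conductorNorm ℤ = N → IsImaginaryQuadratic K →
        Odd (NumberField.discr K) → ¬ p ∣ Units.torsionOrder K → SatisfiesHeegnerHypothesis N K →
        (W.quadraticTwist (NumberField.discr K : ℚ)).entireLFunction 1 ≠ 0 →
        WeierstrassCurve.Affine.Point.map ι.toRatAlgHom P = heegnerPointComplex Dt H →
        ¬ (p : ℤ) ∣ Dt.c → ¬ IsOfFinAddOrder P →
        ∀ (κ : ZpExtension K p), κ.IsAnticyclotomic →
          ∀ (γ : Field.absoluteGaloisGroup K) [Fact (κ.IsTopGenerator γ)]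
            (𝔭 : HeightOneSpectrum (𝓞 K)) (h𝔭 : ((p : ℕ) : 𝓞 K) ∈ 𝔭.asIdeal)
            (he : 𝔭.asIdeal.ramificationIdx (𝓞 ℚ) = 1) (hf : 𝔭.asIdeal.inertiaDeg (𝓞 ℚ) = 1),
            ∀ n : ℕ, XAc.HasCharValuationAt (W.baseChange K) p κ 𝔭 ∅ γ n →
              2 * X11b.padicLogOrd W p (embAt K p 𝔭 h𝔭 he hf) P ≤ (n : ℤ) := by
  sorry

/-- STUB 3 (divisibility at `p = 3`, size XL, NONE): the same bound at `p = 3` (2 411 of 2 560 pairs;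
`e = 2` twist good ordinary at `3`): needs the `p ∣ 6` extension of CGLS §3 / KY24 §3 (Eisenstein
congruences at `p = 3`, `μ = 0` input of Greenberg–Vatsal type for the twist). -/
theorem stub_goodTwo_divisibility_three :
    ∀ (W : WeierstrassCurve ℚ) [W.IsElliptic] [W.IsGloballyMinimal] (p : ℕ) [Fact p.Prime],
      W.analyticRank = 1 → p ≠ 2 → ClassX3 W p → Additive.SubGordTwo W p → p = 3 →
      ∀ (N : ℕ) [NeZero N] (K : Type) [Field K] [NumberField K]
        (Dt : ModularParametrizationData W N) (H : HeegnerDatum N (NumberField.discr K)) (ι : K →+* ℂ)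
        (P : (W.baseChange K).toAffine.Point),
        W.analyticRank = 1 → Additive.N10.Locus W p → W.conductorNorm ℤ = N → IsImaginaryQuadratic K →
        Odd (NumberField.discr K) → ¬ p ∣ Units.torsionOrder K → SatisfiesHeegnerHypothesis N K →
        (W.quadraticTwist (NumberField.discr K : ℚ)).entireLFunction 1 ≠ 0 →
        WeierstrassCurve.Affine.Point.map ι.toRatAlgHom P = heegnerPointComplex Dt H →
        ¬ (p : ℤ) ∣ Dt.c → ¬ IsOfFinAddOrder P →
        ∀ (κ : ZpExtension K p), κ.IsAnticyclotomic →
          ∀ (γ : Field.absoluteGaloisGroup K) [Fact (κ.IsTopGenerator γ)]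
            (𝔭 : HeightOneSpectrum (𝓞 K)) (h𝔭 : ((p : ℕ) : 𝓞 K) ∈ 𝔭.asIdeal)
            (he : 𝔭.asIdeal.ramificationIdx (𝓞 ℚ) = 1) (hf : 𝔭.asIdeal.inertiaDeg (𝓞 ℚ) = 1),
            ∀ n : ℕ, XAc.HasCharValuationAt (W.baseChange K) p κ 𝔭 ∅ γ n →
              2 * X11b.padicLogOrd W p (embAt K p 𝔭 h𝔭 he hf) P ≤ (n : ℤ) := by
  sorry

/-- COMPOSITION (real proof, instantiated on the named stubs so that exactly ONE theorem of this file
concludes the crux by name — the skeleton checker's candidate rule; hypotheses of a skeleton theorem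
must be by-name obligations, so the stub statements are consumed in the body, not as binders): an odd
prime is `3` or `≥ 5`; torsion-ness (`stub_goodTwo_charTorsion`) supplies `n`, the regime's
divisibility stub bounds it. No `sorry` here; `sorryAx` enters only through the three stubs. -/
theorem BranchMCPotGoodTwo_of : BranchMCPotGoodTwo := by
  intro W _ _ p _ hr hp2 hX hS N _ K _ _ Dt H ι P hr' hloc hN hK hodd hunit hHe hL hP hc hnt κ hκ γ _ 𝔭 h𝔭 he hf
  have hp : p.Prime := Fact.out
  have h35 : p = 3 ∨ 5 ≤ p := by
    rcases Nat.lt_or_ge p 5 with h | h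
    · left
      have h2 := hp.two_le
      interval_cases p
      · exact absurd rfl hp2
      · rfl
      · exact absurd hp (by decide)
    · exact Or.inr h
  obtain ⟨n, hn⟩ :=
    stub_goodTwo_charTorsion W p hr hp2 hX hS N K Dt H ι P hr' hloc hN hK hodd hunit hHe hL hP hc hnt κ hκ γ 𝔭 h𝔭 he hf
  rcases h35 with h3 | h5
  · exact ⟨n, hn, stub_goodTwo_divisibility_three W p hr hp2 hX hS h3 N K Dt H ι P hr' hloc hN hK hodd hunit
      hHe hL hP hc hnt κ hκ γ 𝔭 h𝔭 he hf n hn⟩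
  · exact ⟨n, hn, stub_goodTwo_divisibility_five_le W p hr hp2 hX hS h5 N K Dt H ι P hr' hloc hN hK hodd hunit
      hHe hL hP hc hnt κ hκ γ 𝔭 h𝔭 he hf n hn⟩

end Summit.BirchSwinnertonDyer.BirchSwinnertonDyer.Cruxes.BranchMCPotGoodTwo.Birth

end BirthSkeleton

end
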